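import Summits.ValiantsHypothesis.ValiantsHypothesis.Theses.ImmanantSlice
import Literature.Computability.AlgebraicComplexity.EvenCycleCoverVNP
import HarnessLib

/-!
# ImmanantSlice · `EvenCycleCoverNotVP` (stmt-ValiantsHypothesis-4214): the item implies the summit

The support item `EvenCycleCoverNotVP` of route ImmanantSlice says that the signed even-cycle-cover
family `D^even_n = ∑_{σ fixed-point free, all cycles even} sgn σ ∏ᵢ X_{σ i, i}` is NOT a `VP`
family over `ℂ`. Since `(D^even_n)_n ∈ VNP_ℂ`
(`Literature.Computability.AlgebraicComplexity.isVNPFamily_evenCycleCoverPoly`, proved in the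
tree by a colouring/determinant witness), the item implies Valiant's hypothesis `VP_ℂ ≠ VNP_ℂ`
itself (`valiantsHypothesis_of_evenCycleCoverNotVP`): proving it is at least as hard as the summit,
so the item can only be settled cheaply on the negative side (`D^even ∈ VP`, the route's declared
kill switch). Conversely it follows from the crux `EvenCycleDominance` together with
`per ∉ VP` (`evenCycleCoverNotVP_of_evenCycleDominance`). Both are `--supports` lemmas for
stmt-ValiantsHypothesis-4214; neither closes it.
-/

-- `Summit.ValiantsHypothesis.ValiantsHypothesis.…` is the tree's mandated single-conjunct layout
-- (Sub = Summit), so the duplicated namespace component is intended.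
set_option linter.dupNamespace false

namespace Summit.ValiantsHypothesis.ValiantsHypothesis.Theorems

open Literature.Computability.AlgebraicComplexity

/-- The family of the route decl `EvenCycleCoverNotVP` is literally the Literature family
`evenCycleCoverPoly n ℂ`, so the item reads `¬ IsVPFamily (fun n => evenCycleCoverPoly n ℂ)`.
[folklore] -/
theorem evenCycleCoverNotVP_iff :
    Summit.ValiantsHypothesis.ValiantsHypothesis.Theses.ImmanantSlice.EvenCycleCoverNotVP ↔
      ¬ IsVPFamily (fun n => evenCycleCoverPoly n ℂ) :=
  Iff.rfl

/-- **The item implies the summit.** If the signed even-cycle-cover family is not in `VP_ℂ` then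
`VP_ℂ ≠ VNP_ℂ`: the family is in `VNP_ℂ` (`evenCycleCoverFamily_mem_VNP`, Valiant's criterion
instance; Bürgisser 2000, Prop. 2.20), so `VP = VNP` would put it in `VP`
(`mem_VP_ofFintype_iff_holds`). [cite: Burgisser2000, Prop. 2.20] -/
theorem valiantsHypothesis_of_evenCycleCoverNotVP :
    Summit.ValiantsHypothesis.ValiantsHypothesis.Theses.ImmanantSlice.EvenCycleCoverNotVP →
      ValiantsHypothesis := by
  intro hS hEq
  apply hS
  have hVNP := evenCycleCoverFamily_mem_VNP ℂ
  rw [← hEq] at hVNP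
  exact (mem_VP_ofFintype_iff_holds _).1 hVNP

/-- **The item from the crux.** `EvenCycleDominance` (if `D^even ∈ VP` then the permanent is
p-computable) and `per ∉ VP` (the hub's hypothesis form, `Summit.ValiantsHypothesis.Hub`; `per` is
a p-family, `isPFamily_perPoly_holds`) give `EvenCycleCoverNotVP`. [folklore] -/
theorem evenCycleCoverNotVP_of_evenCycleDominance
    (hdom : Summit.ValiantsHypothesis.ValiantsHypothesis.Theses.ImmanantSlice.EvenCycleDominance)
    (hper : ¬ IsVPFamily (fun n => perPoly (Fin n) ℂ)) :
    Summit.ValiantsHypothesis.ValiantsHypothesis.Theses.ImmanantSlice.EvenCycleCoverNotVP :=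
  fun h => hper ⟨isPFamily_perPoly_holds, hdom h⟩

end Summit.ValiantsHypothesis.ValiantsHypothesis.Theorems
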